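import Literature.AlgebraicGeometry.GroupActions.FixedLocusTangentDimension
import Literature.AlgebraicGeometry.Hyperkaehler.AutZeroAnalytification
import Literature.Geometry.Kaehler.FiniteGroupHolomorphicLinearization
import Literature.AlgebraicTopology.SingularHomology.LocalHomologyDimensionAtPoint
import Literature.Geometry.Kaehler.TangentRepresentationFixedPoint
import Literature.AlgebraicGeometry.HodgeTheory.HypersurfaceComplexPoints
import Literature.AlgebraicGeometry.HodgeTheory.ComplexConjugationHolds
import Literature.AlgebraicGeometry.HodgeTheory.RationalHodgeClassesNonempty
import Literature.AlgebraicGeometry.Motives.AlgPointsProperProofs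
import Literature.AlgebraicGeometry.Motives.VarietiesProperProofs
import Mathlib.LinearAlgebra.Complex.FiniteDimensional
import HarnessLib

/-!
# The fixed locus of a finite-order automorphism: dimension of the component through `P` equals `dim (T_P X)^φ` — DISCHARGE of `GroupActions.Milne2017_fixedComponent_dim_eq_finrank_tangentFixed`

Layer `Literature/AlgebraicGeometry/GroupActions`.  Theorems only (no definition, no new named fact;
D-0026): the REFEREED named fact
`Literature.AlgebraicGeometry.GroupActions.Milne2017_fixedComponent_dim_eq_finrank_tangentFixed`
(`FixedLocusTangentDimension.lean`; Iversen 1972 / Fogarty 1973 / H. Cartan 1957; Milne, *Algebraic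
Groups*, Thm. 13.1 with Lemmas 13.4–13.6; Conrad–Gabber–Prasad A.8.10; Görtz–Wedhorn Thm. 6.28) becomes
a theorem of the tree: `Milne2017_fixedComponent_dim_eq_finrank_tangentFixed_holds`.  Cell `hodge-kum4`
(ladder HodgeAV, rung H3), seat p2: the fact is the binder `hTan` of every landed closer of route
`Ventures/KummerFixedLocus` (Route A: `KummerFixedLocusHasFixedPointTangent`, `…TransitiveTangent`,
`…MeetsTranslatesLocal`, `…Split125`).

## The statement (recalled) and the proof

For `X` smooth projective of dimension `n` over `ℂ` and `P ∈ X(ℂ)` the fact asks for an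
`n`-dimensional representation `τ` of `Stab(P) ≤ Aut X` such that for every `φ ∈ Stab(P)` of finite
order and every finite family of smooth projective `Z_j` (of dimensions `d_j`) closed-immersed in `X`
with pairwise disjoint images covering `Fix(φ(ℂ))` exactly, the member through `P` has
`d_j = dim ker(τ φ − 1)`.  KERNEL PROOF, the analytic road of Cartan's linearisation, every input
PROVED in the tree:

* **`X^an` and the tangent representation.**  A Hodge model `φ_A : M → X(ℂ)`
  (`HodgeTheory.nonempty_hodgeModel_holds`; `M` a complex manifold charted on `E ≅ ℂⁿ`,
  `IsAnalytification`) carries the action `χ ↦ φ_A⁻¹ ∘ χ(ℂ) ∘ φ_A` of `Aut X` by biholomorphic maps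
  (`Hyperkaehler.analyticAut`, `contMDiff_analyticAut` — GAGA, `AutZeroAnalytification`); `Stab(P)`
  fixes `a = φ_A⁻¹ P`, and `τ χ = d(φ_A⁻¹ ∘ χ(ℂ) ∘ φ_A)_a ∈ End(E)` is a representation by the chain
  rule at the fixed point (`mfderivEnd_comp_of_apply_eq`; the tangent spaces of `𝓘(ℂ, E)` are `E`).
* **Cartan.**  For `φ` of finite order the finite cyclic group `⟨φ⟩` acts holomorphically fixing `a`;
  H. Cartan's linearisation (`Geometry.Kaehler.exists_linearizing_chart_chartAt`, PROVED by the
  typer of the cell's literature family) gives a chart `σ` at `a` with `⟨φ⟩`-stable source in which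
  the group acts through the tangent representation, so `σ` identifies the fixed points in its source
  with the points of `ker(τ φ − 1)` in its target (`fixedBy_iff_of_linearization`): near `P` the fixed
  locus is homeomorphic to an open subset of the real vector space `ker(τ φ − 1)` of dimension
  `2 dim_ℂ ker(τ φ − 1)`.
* **The partition.**  The members `c_{j'}(Z_{j'}(ℂ))` are compact (`Z_{j'}` is proper,
  `Motives.IsSmoothProjective.isProper_holds`, `Motives.compactSpace_algPoints_of_isProper_holds`),
  hence the complement `N` of the members other than the one through `P` is an open neighbourhood of
  `P` on which the fixed locus IS `c_j(Z_j(ℂ))`; a closed immersion embeds complex points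
  (`Motives.AlgPoints.isEmbedding_map_of_isClosedImmersion`), so near `P` the fixed locus is
  homeomorphic to an open subset of `Z_j^an` (Hodge model of `Z_j`), a manifold charted on `ℂ^{d_j}`,
  i.e. to an open subset of a real vector space of dimension `2 d_j`.
* **Invariance of dimension at a point** (`finrank_eq_of_homeomorph_nhds`: local homology
  `H_k(S | p; ℤ)` of the fixed locus at `P` computed through both local models —
  `isZero_localHomology_of_ne`, `not_isZero_localHomology`, `localHomology.chartXEquiv` of
  `AlgebraicTopology/SingularHomology`; Hatcher Thm. 2.26): `2 d_j = 2 dim_ℂ ker(τ φ − 1)`.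

## References

* [Milne2017] J. S. Milne, *Algebraic Groups*, CUP 2017, Ch. 13, Thm. 13.1, Lemmas 13.4–13.6.
* [Cartan1957QuotientAnalytique] H. Cartan, *Quotient d'un espace analytique par un groupe
  d'automorphismes*, Princeton Math. Ser. 12 (1957), §4.
* [ConradGabberPrasad2015] B. Conrad, O. Gabber, G. Prasad, *Pseudo-reductive groups*, 2nd ed.,
  Prop. A.8.10.
* [HatcherAT2002] A. Hatcher, *Algebraic Topology*, CUP 2002, Thm. 2.26 and §3.3 p. 231.
* [SerreGAGA1956] J.-P. Serre, *Géométrie algébrique et géométrie analytique*, Ann. Inst. Fourier 6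
  (1956), §2.
-/

noncomputable section

open scoped Manifold ContDiff Topology
open CategoryTheory Function Set
open Literature.AlgebraicTopology.SingularHomology

namespace Literature.AlgebraicGeometry.GroupActions

/-! ### Small algebraic helpers -/

section Helpers

/-- A self-homeomorphism fixing `x` has all its powers fixing `x`. [folklore] -/
private theorem homeomorph_pow_apply_of_apply_eq {M : Type*} [TopologicalSpace M] (f : M ≃ₜ M) {x : M}
    (hx : f x = x) (k : ℕ) : (f ^ k) x = x := by
  induction k with
  | zero => rfl
  | succ k ih => rw [pow_succ, Homeomorph.mul_apply, hx, ih]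

/-- A continuous linear map fixing `v` has all its powers fixing `v`. [folklore] -/
private theorem clm_pow_apply_of_apply_eq {E : Type*} [NormedAddCommGroup E] [NormedSpace ℂ E]
    (T : E →L[ℂ] E) {v : E} (hv : T v = v) (k : ℕ) : (T ^ k) v = v := by
  induction k with
  | zero => rfl
  | succ k ih =>
    rw [pow_succ']
    show T ((T ^ k) v) = v
    rw [ih, hv]

/-- In a group, every element of the cyclic subgroup generated by an element `ψ` of finite order is
a natural power of the generator `⟨ψ, _⟩`. [folklore] -/
private theorem exists_eq_generator_pow {Γ : Type*} [Group Γ] {ψ : Γ} (hψ : IsOfFinOrder ψ)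
    (g : Subgroup.zpowers ψ) : ∃ k : ℕ, g = (⟨ψ, Subgroup.mem_zpowers ψ⟩ : Subgroup.zpowers ψ) ^ k := by
  obtain ⟨k, hk⟩ := (hψ.mem_powers_iff_mem_zpowers).2 g.2
  exact ⟨k, Subtype.ext (by simp [← hk])⟩

end Helpers

/-! ### The discharge -/

section Discharge

open Literature.AlgebraicGeometry.Motives (SchemeOver ComplexPoints IsSmoothProjective AlgPoints)
open Literature.NumberTheory.Transcendental Literature.AlgebraicGeometry.Hyperkaehler
open Literature.Geometry.Kaehler

/-- **Iversen / Fogarty / Cartan — Milne Thm. 13.1, CGP A.8.10, GW 6.28: discharge of the named fact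
`Milne2017_fixedComponent_dim_eq_finrank_tangentFixed`.**  KERNEL PROOF (analytic road): take a Hodge
model `φ : M → X(ℂ)` of the smooth projective `X` (GAGA: `X^an`, PROVED `nonempty_hodgeModel_holds`);
the tangent representation of `Stab(P)` is `χ ↦ d(φ⁻¹ ∘ χ(ℂ) ∘ φ)_a` on the model space `E ≅ ℂⁿ`
(`a = φ⁻¹ P`; automorphisms act holomorphically on `X^an`, `contMDiff_analyticAut`; a homomorphism by
the chain rule at the fixed point).  For `χ` of finite order, H. Cartan's linearisation
(`exists_linearizing_chart_chartAt`, PROVED) gives holomorphic coordinates `σ` at `a` in which the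
finite cyclic group `⟨χ⟩` acts linearly through the tangent representation, so near `P` the fixed locus
is homeomorphic to an open piece of the linear subspace `ker(dχ_a − 1)` (real dimension `2 dim ker`);
on the other hand near `P` it is the member `c_j(Z_j(ℂ))` of the given smooth projective partition
(the other members are compact — `compactSpace_algPoints_of_isProper_holds` — and disjoint from it),
homeomorphic (closed immersions embed complex points, `AlgPoints.isEmbedding_map_of_isClosedImmersion`)
to an open piece of `Z_j^an`, a manifold on `ℂ^{d_j}`; invariance of dimension at the point `P`
(local homology, `finrank_eq_of_homeomorph_nhds`) gives `2 d_j = 2 dim ker(dχ_a − 1)`.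
[cite: Milne2017, Ch. 13 Thm. 13.1, Lemma 13.4 and proof of Lemma 13.6]
[cite: Cartan1957QuotientAnalytique, §4 (proof of Théorème 4)] [cite: HatcherAT2002, Thm. 2.26] -/
theorem Milne2017_fixedComponent_dim_eq_finrank_tangentFixed_holds :
    Milne2017_fixedComponent_dim_eq_finrank_tangentFixed := by
  intro n X hX P
  classical
  -- the analytification `φ : M → X(ℂ)` of a Hodge model, `a = φ⁻¹ P`
  obtain ⟨A⟩ := HodgeTheory.nonempty_hodgeModel_holds (n := n) (X := X) hX
  haveI hT2X : T2Space (ComplexPoints X) := A.t2Space_complexPoints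
  have hφ : IsAnalytification A.model X n A.toComplexPoints := A.isAnalytification
  set h : A.carrier ≃ₜ ComplexPoints X := hφ.homeomorph with hh
  have hcoe : ∀ m, h m = A.toComplexPoints m := fun m => rfl
  set a : A.carrier := h.symm P with ha
  -- the action of `Stab(P)` on `X^an`, fixing `a`, by holomorphic maps
  set ρ₀ : pointStabilizer X P →* (A.carrier ≃ₜ A.carrier) :=
    (analyticAut hφ).comp (pointStabilizer X P).subtype with hρ₀
  have hρ₀_apply : ∀ (χ : pointStabilizer X P) (m : A.carrier),
      ρ₀ χ m = h.symm (AlgPoints.map (χ : Aut X).hom (h m)) := fun χ m => rfl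
  have hρ₀a : ∀ χ : pointStabilizer X P, ρ₀ χ a = a := by
    intro χ
    rw [hρ₀_apply, ha, h.apply_symm_apply, mem_pointStabilizer_iff.1 χ.2]
  have hρ₀d : ∀ χ : pointStabilizer X P,
      MDifferentiable 𝓘(ℂ, A.model) 𝓘(ℂ, A.model) (ρ₀ χ) := fun χ =>
    mdifferentiable_analyticAut hX hφ _
  -- the tangent representation at `a`
  let τ : Representation ℂ (pointStabilizer X P) A.model :=
    { toFun := fun χ => @id (A.model →ₗ[ℂ] A.model)
        (ContinuousLinearMap.toLinearMap (mfderiv 𝓘(ℂ, A.model) 𝓘(ℂ, A.model) (ρ₀ χ) a))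
      map_one' := by
        have h1 : ((ρ₀ 1 : A.carrier ≃ₜ A.carrier) : A.carrier → A.carrier) = id := by
          rw [map_one]; rfl
        show @id (A.model →ₗ[ℂ] A.model) (ContinuousLinearMap.toLinearMap
          (mfderiv 𝓘(ℂ, A.model) 𝓘(ℂ, A.model) (ρ₀ 1) a)) = 1
        rw [mfderivEnd_congr_fun h1 a]
        exact mfderivEnd_id a
      map_mul' := fun χ χ' => by
        have hm : ((ρ₀ (χ * χ') : A.carrier ≃ₜ A.carrier) : A.carrier → A.carrier) =
            (ρ₀ χ) ∘ (ρ₀ χ') := by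
          rw [map_mul]; rfl
        show @id (A.model →ₗ[ℂ] A.model) (ContinuousLinearMap.toLinearMap
            (mfderiv 𝓘(ℂ, A.model) 𝓘(ℂ, A.model) (ρ₀ (χ * χ')) a)) =
          @id (A.model →ₗ[ℂ] A.model) (ContinuousLinearMap.toLinearMap
            (mfderiv 𝓘(ℂ, A.model) 𝓘(ℂ, A.model) (ρ₀ χ) a)) *
          @id (A.model →ₗ[ℂ] A.model) (ContinuousLinearMap.toLinearMap
            (mfderiv 𝓘(ℂ, A.model) 𝓘(ℂ, A.model) (ρ₀ χ') a))
        rw [mfderivEnd_congr_fun hm a]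
        exact mfderivEnd_comp_of_apply_eq (hρ₀a χ') (hρ₀d χ a) (hρ₀d χ' a) }
  have hτ : ∀ χ : pointStabilizer X P, ∀ v : A.model,
      τ χ v = (mfderiv 𝓘(ℂ, A.model) 𝓘(ℂ, A.model) (ρ₀ χ) a) v :=
    fun χ v => rfl
  refine ⟨A.model, inferInstance, inferInstance, inferInstance, τ, hφ.finrank_eq, ?_⟩
  intro ψ hψ J _ Z d c hZ hc hdisj hfix j hPj
  /- ───── the fixed set `F = Fix(ψ(ℂ)) ⊆ X(ℂ)` and the members `K j'` of the partition ───── -/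
  have hmemF : ∀ x : ComplexPoints X,
      x ∈ {x : ComplexPoints X | Motives.AlgPoints.mapContinuous (L := ℂ) ψ.val.hom x = x} ↔
        AlgPoints.map (ψ : Aut X).hom x = x := fun x => Iff.rfl
  set F : Set (ComplexPoints X) :=
    {x : ComplexPoints X | Motives.AlgPoints.mapContinuous (L := ℂ) ψ.val.hom x = x} with hFdef
  set K : J → Set (ComplexPoints X) := fun j' =>
    Set.range (Motives.AlgPoints.mapContinuous (L := ℂ) (c j')) with hKdef
  have hFK : F = ⋃ j', K j' := hfix
  have hPK : P ∈ K j := hPj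
  have hPF : P ∈ F := by
    rw [hFK]; exact Set.mem_iUnion.2 ⟨j, hPK⟩
  -- the members are compact (`Z j'` is proper), hence closed
  have hKc : ∀ j', IsCompact (K j') := by
    intro j'
    haveI := Motives.IsSmoothProjective.isProper_holds (hZ j')
    haveI : CompactSpace (ComplexPoints (Z j')) :=
      Motives.compactSpace_algPoints_of_isProper_holds (Z j') ℂ
    exact isCompact_range (Motives.AlgPoints.mapContinuous (L := ℂ) (c j')).continuous
  -- the open neighbourhood `N ∋ P` missing the other members; on it `F` is `K j`
  set N : Set (ComplexPoints X) := (⋃ j' ∈ {j' : J | j' ≠ j}, K j')ᶜ with hNdef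
  have hNopen : IsOpen N := by
    rw [hNdef, isOpen_compl_iff]
    exact (Set.toFinite _).isClosed_biUnion fun j' _ => (hKc j').isClosed
  have hPN : P ∈ N := by
    rw [hNdef, Set.mem_compl_iff, Set.mem_iUnion₂]
    rintro ⟨j', hj', hPj'⟩
    exact Set.disjoint_left.1 (hdisj j j' (Ne.symm hj')) hPK hPj'
  have hFN : ∀ x, x ∈ F → x ∈ N → x ∈ K j := by
    intro x hxF hxN
    rw [hFK, Set.mem_iUnion] at hxF
    obtain ⟨j', hj'⟩ := hxF
    by_cases hjj : j' = j
    · exact hjj ▸ hj'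
    · exact absurd (Set.mem_iUnion₂.2 ⟨j', hjj, hj'⟩) hxN
  /- ───── witness 1: near `P`, `F` is an open piece of the complex manifold `Z_j^an` ───── -/
  obtain ⟨B⟩ := HodgeTheory.nonempty_hodgeModel_holds (n := d j) (X := Z j) (hZ j)
  have hB : IsAnalytification B.model (Z j) (d j) B.toComplexPoints := B.isAnalytification
  haveI := hc j
  set g : B.carrier → ComplexPoints X := fun z => AlgPoints.map (c j) (B.toComplexPoints z)
    with hgdef
  have hgemb : Topology.IsEmbedding g :=
    (Motives.AlgPoints.isEmbedding_map_of_isClosedImmersion (L := ℂ) (c j)).comp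
      hB.homeomorph.isEmbedding
  have hBsymm : ∀ q, B.toComplexPoints (hB.homeomorph.symm q) = q := fun q =>
    hB.homeomorph.apply_symm_apply q
  have hgK : Set.range g = K j := by
    ext x
    constructor
    · rintro ⟨z, rfl⟩
      exact ⟨B.toComplexPoints z, rfl⟩
    · rintro ⟨q, rfl⟩
      refine ⟨hB.homeomorph.symm q, ?_⟩
      show AlgPoints.map (c j) (B.toComplexPoints (hB.homeomorph.symm q)) = _
      rw [hBsymm]
      rfl
  obtain ⟨q₀, hq₀⟩ := hPj
  set z₀ : B.carrier := hB.homeomorph.symm q₀ with hz₀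
  have hgz₀ : g z₀ = P := by
    show AlgPoints.map (c j) (B.toComplexPoints (hB.homeomorph.symm q₀)) = P
    rw [hBsymm]
    exact hq₀
  set κ := chartAt B.model z₀ with hκ
  set W : Set B.carrier := κ.source ∩ g ⁻¹' N with hWdef
  have hWopen : IsOpen W := κ.open_source.inter (hNopen.preimage hgemb.continuous)
  have hz₀W : z₀ ∈ W := ⟨mem_chart_source _ _, by rw [Set.mem_preimage, hgz₀]; exact hPN⟩
  have hWsrc : W ⊆ κ.source := Set.inter_subset_left
  have hgWF : g '' W ⊆ F := by
    rintro _ ⟨w, -, rfl⟩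
    have hw : g w ∈ K j := by rw [← hgK]; exact Set.mem_range_self w
    rw [hFK]
    exact Set.mem_iUnion.2 ⟨j, hw⟩
  obtain ⟨O', hO'open, hO'W⟩ := hgemb.isInducing.isOpen_iff.1 hWopen
  set U₁ : Set F := {x | (x : ComplexPoints X) ∈ g '' W} with hU₁def
  have hU₁eq : U₁ = Subtype.val ⁻¹' (O' ∩ N) := by
    ext x
    constructor
    · rintro ⟨w, hw, hwx⟩
      refine ⟨?_, ?_⟩
      · have hw' : w ∈ g ⁻¹' O' := by rw [hO'W]; exact hw
        rw [Set.mem_preimage, hwx] at hw'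
        exact hw'
      · have hw' : g w ∈ N := hw.2
        rw [hwx] at hw'
        exact hw'
    · rintro ⟨hxO, hxN⟩
      obtain ⟨w, hw⟩ : (x : ComplexPoints X) ∈ Set.range g := by
        rw [hgK]; exact hFN x x.2 hxN
      refine ⟨w, ?_, hw⟩
      rw [← hO'W, Set.mem_preimage, hw]
      exact hxO
  have hU₁open : IsOpen U₁ := by
    rw [hU₁eq]; exact (hO'open.inter hNopen).preimage continuous_subtype_val
  have hpU₁ : (⟨P, hPF⟩ : F) ∈ U₁ := ⟨z₀, hz₀W, hgz₀⟩
  have hO₁open : IsOpen (κ '' W) := κ.isOpen_image_of_subset_source hWopen hWsrc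
  have eW : W ≃ₜ (g '' W) :=
    (hgemb.comp Topology.IsEmbedding.subtypeVal).toHomeomorph.trans
      (Homeomorph.setCongr (by rw [Set.range_comp, Subtype.range_coe]))
  have eκ : W ≃ₜ (κ '' W) := κ.homeomorphOfImageSubsetSource hWsrc rfl
  have eU : U₁ ≃ₜ (g '' W) :=
    { toFun := fun x => ⟨x.1.1, x.2⟩
      invFun := fun y => ⟨⟨y.1, hgWF y.2⟩, y.2⟩
      left_inv := fun _ => rfl
      right_inv := fun _ => rfl
      continuous_toFun := (continuous_subtype_val.comp continuous_subtype_val).subtype_mk _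
      continuous_invFun := (continuous_subtype_val.subtype_mk _).subtype_mk _ }
  have e₁ : U₁ ≃ₜ (κ '' W) := eU.trans (eW.symm.trans eκ)
  have hdimB : Module.finrank ℝ B.model = 2 * d j := by
    rw [finrank_real_of_complex, hB.finrank_eq]
  /- ───── witness 2: near `P`, `F` is an open piece of `ker(dψ_a − 1)` (Cartan) ───── -/
  haveI hGfin : Finite (Subgroup.zpowers ψ) := Finite.of_equiv _ (finEquivZPowers hψ)
  set ρ : Subgroup.zpowers ψ →* (A.carrier ≃ₜ A.carrier) :=
    ρ₀.comp (Subgroup.zpowers ψ).subtype with hρdef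
  have hρ_apply : ∀ (γ : Subgroup.zpowers ψ) (m : A.carrier),
      ρ γ m = h.symm (AlgPoints.map ((γ : pointStabilizer X P) : Aut X).hom (h m)) := fun γ m => rfl
  have hρhol : ∀ γ : Subgroup.zpowers ψ,
      ContMDiff 𝓘(ℂ, A.model) 𝓘(ℂ, A.model) ω (ρ γ : A.carrier → A.carrier) := fun γ =>
    contMDiff_analyticAut hX hφ _
  have hρa : ∀ γ : Subgroup.zpowers ψ, ρ γ a = a := fun γ => hρ₀a γ.1
  obtain ⟨σ, -, haσ, -, hstab, L, hlin, hL, -⟩ := exists_linearizing_chart_chartAt ρ hρhol hρa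
  -- every element of `⟨ψ⟩` is a power of the generator
  have hgen : ∀ γ : Subgroup.zpowers ψ,
      ∃ k : ℕ, γ = (⟨ψ, Subgroup.mem_zpowers ψ⟩ : Subgroup.zpowers ψ) ^ k :=
    exists_eq_generator_pow hψ
  have hfixM : ∀ m : A.carrier, ρ ⟨ψ, Subgroup.mem_zpowers ψ⟩ m = m →
      ∀ γ : Subgroup.zpowers ψ, ρ γ m = m := by
    intro m hm γ
    obtain ⟨k, rfl⟩ := hgen γ
    rw [map_pow]
    exact homeomorph_pow_apply_of_apply_eq _ hm k
  have hfixL : ∀ v : A.model, L ⟨ψ, Subgroup.mem_zpowers ψ⟩ v = v →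
      ∀ γ : Subgroup.zpowers ψ, L γ v = v := by
    intro v hv γ
    obtain ⟨k, rfl⟩ := hgen γ
    rw [map_pow]
    exact clm_pow_apply_of_apply_eq _ hv k
  -- `m` is `ψ`-fixed iff `h m ∈ F`
  have hρψ : ∀ m : A.carrier, ρ ⟨ψ, Subgroup.mem_zpowers ψ⟩ m = m ↔ h m ∈ F := by
    intro m
    rw [hρ_apply]
    show h.symm (AlgPoints.map (ψ : Aut X).hom (h m)) = m ↔ AlgPoints.map (ψ : Aut X).hom (h m) = h m
    constructor
    · intro hm
      have hm' := congrArg h hm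
      rwa [h.apply_symm_apply] at hm'
    · intro hm
      rw [hm, h.symm_apply_apply]
  -- the kernel of `τ ψ − 1` is the fixed subspace of the tangent action of the generator
  have hτL : ∀ v : A.model, τ ψ v = L ⟨ψ, Subgroup.mem_zpowers ψ⟩ v := by
    intro v
    rw [hτ, hL]
    rfl
  set Wc : Submodule ℂ A.model := LinearMap.ker (τ ψ - 1) with hWc
  have hmemWc : ∀ v, v ∈ Wc ↔ L ⟨ψ, Subgroup.mem_zpowers ψ⟩ v = v := by
    intro v
    rw [hWc, LinearMap.mem_ker, LinearMap.sub_apply, sub_eq_zero, hτL, Module.End.one_apply]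
  set U₂ : Set F := {x | (x : ComplexPoints X) ∈ h '' σ.source} with hU₂def
  have hU₂open : IsOpen U₂ := (h.isOpenMap _ σ.open_source).preimage continuous_subtype_val
  have hpU₂ : (⟨P, hPF⟩ : F) ∈ U₂ := ⟨a, haσ, by rw [ha, h.apply_symm_apply]⟩
  set O₂ : Set Wc := {w | (w : A.model) ∈ σ.target} with hO₂def
  have hO₂open : IsOpen O₂ := σ.open_target.preimage continuous_subtype_val
  have hsrc : ∀ x : U₂, h.symm (x : ComplexPoints X) ∈ σ.source := by
    intro x
    obtain ⟨m, hm, hmx⟩ := x.2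
    rw [← hmx, h.symm_apply_apply]
    exact hm
  have hfix₂ : ∀ x : U₂, ∀ γ : Subgroup.zpowers ψ,
      ρ γ (h.symm (x : ComplexPoints X)) = h.symm (x : ComplexPoints X) := by
    intro x
    apply hfixM
    rw [hρψ, h.apply_symm_apply]
    exact x.1.2
  have htgt : ∀ w : O₂, σ.symm ((w : Wc) : A.model) ∈ σ.source := fun w => σ.map_target w.2
  have hfix₂' : ∀ w : O₂, ∀ γ : Subgroup.zpowers ψ,
      ρ γ (σ.symm ((w : Wc) : A.model)) = σ.symm ((w : Wc) : A.model) := by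
    intro w
    refine (fixedBy_iff_of_linearization hstab hlin (htgt w)).2 ?_
    intro γ
    rw [σ.right_inv w.2]
    exact hfixL _ ((hmemWc _).1 (w : Wc).2) γ
  have e₂ : U₂ ≃ₜ O₂ :=
    { toFun := fun x => ⟨⟨σ (h.symm (x : ComplexPoints X)),
          (hmemWc _).2 ((fixedBy_iff_of_linearization hstab hlin (hsrc x)).1 (hfix₂ x)
            ⟨ψ, Subgroup.mem_zpowers ψ⟩)⟩,
          σ.map_source (hsrc x)⟩
      invFun := fun w => ⟨⟨h (σ.symm ((w : Wc) : A.model)),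
          (hρψ _).1 (hfix₂' w ⟨ψ, Subgroup.mem_zpowers ψ⟩)⟩,
          ⟨σ.symm ((w : Wc) : A.model), htgt w, rfl⟩⟩
      left_inv := fun x => by
        apply Subtype.ext
        apply Subtype.ext
        show h (σ.symm (σ (h.symm (x : ComplexPoints X)))) = x
        rw [σ.left_inv (hsrc x), h.apply_symm_apply]
      right_inv := fun w => by
        apply Subtype.ext
        apply Subtype.ext
        show σ (h.symm (h (σ.symm ((w : Wc) : A.model)))) = w
        rw [h.symm_apply_apply, σ.right_inv w.2]
      continuous_toFun := by
        apply Continuous.subtype_mk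
        apply Continuous.subtype_mk
        exact σ.continuousOn.comp_continuous
          (h.symm.continuous.comp (continuous_subtype_val.comp continuous_subtype_val)) hsrc
      continuous_invFun := by
        apply Continuous.subtype_mk
        apply Continuous.subtype_mk
        exact h.continuous.comp (σ.continuousOn_symm.comp_continuous
          (continuous_subtype_val.comp continuous_subtype_val) fun w => w.2) }
  have hdimW : Module.finrank ℝ Wc = 2 * Module.finrank ℂ Wc := finrank_real_of_complex Wc
  /- ───── invariance of dimension at `P` ───── -/
  have hdim := finrank_eq_of_homeomorph_nhds hU₁open hpU₁ hO₁open e₁ hU₂open hpU₂ hO₂open e₂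
  rw [hdimB, hdimW] at hdim
  omega

end Discharge

end Literature.AlgebraicGeometry.GroupActions

end
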